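import Literature.NumberTheory.GaloisRepresentations.PicardTateModuleResidual
import Literature.NumberTheory.GaloisRepresentations.AbsIrreducibleIndexTwo
import Literature.NumberTheory.GaloisRepresentations.FramedRepDualIrreducible
import Literature.NumberTheory.GaloisRepresentations.IntegralGaloisAction
import Literature.NumberTheory.EllipticCurves.TateModuleContinuityProofs
import HarnessLib

/-!
# The `λ`-adic representation of a Picard curve: frame `Γ_{ℚ(ω)} → GL₃(ℤ₃[ω]) → GL₃(ℚ̄₃)` and
residual absolute irreducibility

Topic `Literature/NumberTheory/GaloisRepresentations` (Upton 2009; continues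
`PicardTateModuleEisenstein`, `PicardTateModuleResidual`).  For a quartic `f ∈ ℤ[X]` separable over
`ℚ` and `K ⊇ ℚ(ω)` (`IsCyclotomicExtension {3} ℚ K`, chosen root `zeta3 K`), the Tate module
`T = T₃ J(C_f)` of the Picard curve `y³ = f(x)` is a `ℤ₃[ω]`-module on which `Γ_K` acts linearly
(local instances `picardEisensteinModule`, …); given the torsion count `#J_f[3ⁿ] = 3^{6n}` (hypothesis
`hcard`) it is free of rank `3`.  This file builds the framed representation and proves its absolute
irreducibility from the residual picture:

* `picardMatrixRepO b : Γ_K →* GL₃(ℤ₃[ω])` (matrices in a `ℤ₃[ω]`-basis `b`), `trace_picardMatrixRepO`;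
* the embedding `ω ↦ u` (`u² + u + 1 = 0` in `ℚ̄₃`): `norm_lift_le_one`, `eisensteinToIntegers u hu :
  ℤ₃[ω] →+* ℤ̄₃`, `residue_eisensteinToIntegers_lam` (`λ ↦ 0` in the residue field), `residue_three_eq_zero`;
* `picardRho0` (`GL₃(ℤ̄₃)`-valued) and **`picardRho1 hcard b u hu : FramedGaloisRep K ℚ̄₃ 3`**, continuous
  because the `ℤ₃`-coordinates of the entries are entries of the continuous `ℤ₃`-representation
  `picardTateGaloisRep` in the basis `{b_j, ω b_j}` (`continuous_repr_picardMatrixRepO`);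
  `trace_picardRho1` (`tr ρ₁ = σ ∘ tr_{ℤ₃[ω]}`);
* **`picardRho1_isAbsolutelyIrreducible`**: in the basis of `picard_exists_basis_repr_smul_congr` the
  reduction of `ρ₀` is `γ ↦ C(γ)`, the augmentation representation of `Γ_K` on the four roots over
  `𝔽̄₃` (`isIrreducible_glStd_comp_of_coe_eq_reindex_augStdMatrix`,
  `augmentationRep_rootSet_map_isIrreducible`, `Gal(f) ⊇ A₄`), so `ρ₁` is residually absolutely
  irreducible, hence absolutely irreducible (`IsResiduallyAbsIrreducible.isAbsolutelyIrreducible`);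
* the reduction of deck transformations modulo a prime of `\bar ℤ_K`
  (`CyclicCoverDeck.toAbsIntegers`, `CyclicCoverDeck.reduceMod`), used by the local analysis in
  `PicardLambdaAdicRepLocal`.

All definitions are genuine; no named facts; the torsion count is the hypothesis `hcard` throughout.

## References
* C. Upton, *Galois representations attached to Picard curves*, J. Algebra 322 (2009), §§2–4. [Upton2009]
* J.-P. Serre, *Abelian ℓ-adic representations and elliptic curves* (1968), Ch. I §1.1. [SerreAbelianLadic1968]
* H. Darmon, F. Diamond, R. Taylor, *Fermat's Last Theorem* (1995), §2.1. [DarmonDiamondTaylor1995]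
-/

noncomputable section

open Polynomial

namespace Literature.NumberTheory.GaloisRepresentations

open scoped NumberField

attribute [local instance] Ideal.Quotient.field

section ReduceDeck

variable {K : Type*} [Field K]

/-- An `m`-th root of unity of `K̄` is an algebraic integer. [folklore] -/
theorem CyclicCoverDeck.isIntegral_val {m : ℕ} [NeZero m] (ζ : CyclicCoverDeck (AlgebraicClosure K) m) :
    IsIntegral (𝓞 K) ζ.val :=
  IsIntegral.of_pow (NeZero.pos m) (by rw [CyclicCoverDeck.val_pow]; exact isIntegral_one)

/-- The algebraic integer underlying an `m`-th root of unity of `K̄`. [folklore] -/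
def CyclicCoverDeck.toAbsIntegers {m : ℕ} [NeZero m] (ζ : CyclicCoverDeck (AlgebraicClosure K) m) :
    absIntegers (𝓞 K) K :=
  ⟨ζ.val, CyclicCoverDeck.isIntegral_val ζ⟩

/-- Unfolding lemma for `CyclicCoverDeck.toAbsIntegers`. [folklore] -/
@[simp]
theorem CyclicCoverDeck.coe_toAbsIntegers {m : ℕ} [NeZero m] (ζ : CyclicCoverDeck (AlgebraicClosure K) m) :
    (CyclicCoverDeck.toAbsIntegers ζ : AlgebraicClosure K) = ζ.val :=
  rfl

/-- `ζ^m = 1` in `\bar ℤ_K`. [folklore] -/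
theorem CyclicCoverDeck.toAbsIntegers_pow {m : ℕ} [NeZero m] (ζ : CyclicCoverDeck (AlgebraicClosure K) m) :
    CyclicCoverDeck.toAbsIntegers ζ ^ m = 1 :=
  Subtype.ext (by rw [SubmonoidClass.coe_pow, CyclicCoverDeck.coe_toAbsIntegers, CyclicCoverDeck.val_pow,
    OneMemClass.coe_one])

/-- `toAbsIntegers 1 = 1`. [folklore] -/
theorem CyclicCoverDeck.toAbsIntegers_one {m : ℕ} [NeZero m] :
    CyclicCoverDeck.toAbsIntegers (1 : CyclicCoverDeck (AlgebraicClosure K) m) = 1 :=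
  Subtype.ext (by rw [CyclicCoverDeck.coe_toAbsIntegers, CyclicCoverDeck.val_one, OneMemClass.coe_one])

/-- `toAbsIntegers` is multiplicative. [folklore] -/
theorem CyclicCoverDeck.toAbsIntegers_mul {m : ℕ} [NeZero m] (ζ ξ : CyclicCoverDeck (AlgebraicClosure K) m) :
    CyclicCoverDeck.toAbsIntegers (ζ * ξ) = CyclicCoverDeck.toAbsIntegers ζ * CyclicCoverDeck.toAbsIntegers ξ :=
  Subtype.ext (by rw [MulMemClass.coe_mul, CyclicCoverDeck.coe_toAbsIntegers, CyclicCoverDeck.coe_toAbsIntegers,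
    CyclicCoverDeck.coe_toAbsIntegers, CyclicCoverDeck.val_mul])

variable (K) in
/-- **Reduction of the deck group modulo `𝔓`**: `μ_m(K̄) → μ_m(\bar ℤ_K / 𝔓)`, `ζ ↦ ζ mod 𝔓` (roots of
unity are algebraic integers).  Along it the deck transformation `y ↦ ζ y` of `C_f` over `K̄` reduces to
the deck transformation `y ↦ ζ̄ y` of the reduced curve. [folklore] -/
def CyclicCoverDeck.reduceMod (m : ℕ) [NeZero m] (𝔓 : Ideal (absIntegers (𝓞 K) K)) [𝔓.IsMaximal] :
    CyclicCoverDeck (AlgebraicClosure K) m →* CyclicCoverDeck (absIntegers (𝓞 K) K ⧸ 𝔓) m where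
  toFun ζ := CyclicCoverDeck.equivRootsOfUnity.symm
    (rootsOfUnity.mkOfPowEq (Ideal.Quotient.mk 𝔓 (CyclicCoverDeck.toAbsIntegers ζ))
      (by rw [← map_pow, CyclicCoverDeck.toAbsIntegers_pow, map_one]))
  map_one' := CyclicCoverDeck.val_injective (by
    change Ideal.Quotient.mk 𝔓 (CyclicCoverDeck.toAbsIntegers (1 : CyclicCoverDeck (AlgebraicClosure K) m)) =
      (1 : CyclicCoverDeck (absIntegers (𝓞 K) K ⧸ 𝔓) m).val
    rw [CyclicCoverDeck.toAbsIntegers_one, map_one, CyclicCoverDeck.val_one])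
  map_mul' ζ ξ := CyclicCoverDeck.val_injective (by
    rw [CyclicCoverDeck.val_mul]
    change Ideal.Quotient.mk 𝔓 (CyclicCoverDeck.toAbsIntegers (ζ * ξ)) =
      Ideal.Quotient.mk 𝔓 (CyclicCoverDeck.toAbsIntegers ζ) * Ideal.Quotient.mk 𝔓 (CyclicCoverDeck.toAbsIntegers ξ)
    rw [CyclicCoverDeck.toAbsIntegers_mul, map_mul])

/-- The root of unity underlying `reduceMod ζ` is `ζ mod 𝔓`. [folklore] -/
@[simp]
theorem CyclicCoverDeck.val_reduceMod {m : ℕ} [NeZero m] (𝔓 : Ideal (absIntegers (𝓞 K) K)) [𝔓.IsMaximal]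
    (ζ : CyclicCoverDeck (AlgebraicClosure K) m) :
    (CyclicCoverDeck.reduceMod K m 𝔓 ζ).val = Ideal.Quotient.mk 𝔓 (CyclicCoverDeck.toAbsIntegers ζ) :=
  rfl

end ReduceDeck

end Literature.NumberTheory.GaloisRepresentations



namespace Literature.NumberTheory.GaloisRepresentations

open Literature.NumberTheory.EllipticCurves Field
open scoped NumberField

section PicardFrame

variable (K : Type) [Field K] [CharZero K] [IsCyclotomicExtension {3} ℚ K]

/-- A chosen primitive cube root of unity `ω ∈ K ⊇ ℚ(ω)`. [folklore] -/
def zeta3 : K := (exists_isPrimitiveRoot_three_of_isCyclotomicExtension K).choose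

/-- `zeta3 K` is a primitive cube root of unity. [folklore] -/
theorem isPrimitiveRoot_zeta3 : IsPrimitiveRoot (zeta3 K) 3 :=
  (exists_isPrimitiveRoot_three_of_isCyclotomicExtension K).choose_spec

/-- The chosen `ω` as an algebraic integer. [folklore] -/
def zeta3Int : 𝓞 K := ⟨zeta3 K, (isPrimitiveRoot_zeta3 K).isIntegral (by norm_num)⟩

/-- `zeta3Int K` is a primitive cube root of unity in `𝓞 K`. [folklore] -/
theorem isPrimitiveRoot_zeta3Int : IsPrimitiveRoot (zeta3Int K) 3 :=
  IsPrimitiveRoot.of_map_of_injective (f := algebraMap (𝓞 K) K) (by exact isPrimitiveRoot_zeta3 K)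
    NumberField.RingOfIntegers.coe_injective


variable (f : ℤ[X]) [hf4 : Fact (f.natDegree = 4)] [hfs : Fact (f.map (Int.castRingHom ℚ)).Separable]

omit [IsCyclotomicExtension {3} ℚ K] in
/-- (Local instance.) `y³ - f_K(x)` is irreducible for the Picard quartic. [folklore] -/
theorem fact_irreducible_picard_inst :
    Fact (Irreducible (superellipticPoly K (AlgebraicClosure K) 3 (f.map (algebraMap ℤ K)))) :=
  fact_irreducible_superellipticPoly_picard K hf4.out hfs.out

attribute [local instance] fact_irreducible_picard_inst

/-- (Local instance.) The `ℤ₃[ω]`-module structure on `T₃ J(C_f)`, `ω ↦ (y ↦ ζ y)` for the chosen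
`ζ = zeta3 K`. [cite: Upton2009, §2] -/
abbrev picardEisensteinModule : Module PadicEisenstein (TateModule (GeomPic K 3 (f.map (algebraMap ℤ K))) 3) :=
  tateModulePadicEisenstein (f.map (algebraMap ℤ K)) (isPrimitiveRoot_zeta3 K)
    (separable_map_algebraMap_int K hfs.out) (not_three_dvd_natDegree_map K hf4.out)

attribute [local instance] picardEisensteinModule

/-- (Local instance.) Compatibility of the `ℤ₃`- and `ℤ₃[ω]`-structures. [folklore] -/
theorem picard_isScalarTower_inst :
    IsScalarTower ℤ_[3] PadicEisenstein (TateModule (GeomPic K 3 (f.map (algebraMap ℤ K))) 3) :=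
  isScalarTower_tateModule (isPrimitiveRoot_zeta3 K) (separable_map_algebraMap_int K hfs.out)
    (not_three_dvd_natDegree_map K hf4.out)

attribute [local instance] picard_isScalarTower_inst

/-- (Local instance.) `Γ_K` acts `ℤ₃[ω]`-linearly on `T₃ J(C_f)`. [cite: Upton2009, §2] -/
theorem picard_smulCommClass_inst :
    SMulCommClass (absoluteGaloisGroup K) PadicEisenstein (TateModule (GeomPic K 3 (f.map (algebraMap ℤ K))) 3) :=
  ⟨fun g z a => absoluteGaloisGroup_smul_padicEisenstein_smul (isPrimitiveRoot_zeta3 K)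
    (separable_map_algebraMap_int K hfs.out) (not_three_dvd_natDegree_map K hf4.out) g z a⟩

attribute [local instance] picard_smulCommClass_inst

variable {K f}

/-- **`ρ_O : Γ_K → GL₃(ℤ₃[ω])`**: the action of `Γ_K` on `T₃ J(C_f) ≅ ℤ₃[ω]³` written in a `ℤ₃[ω]`-basis
`b`. [cite: Upton2009, §2] -/
def picardMatrixRepO (b : Module.Basis (Fin 3) PadicEisenstein (TateModule (GeomPic K 3 (f.map (algebraMap ℤ K))) 3)) :
    absoluteGaloisGroup K →* GL (Fin 3) PadicEisenstein :=
  (((LinearMap.toMatrixAlgEquiv b).toAlgHom.toRingHom.toMonoidHom).comp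
    (DistribMulAction.toModuleEnd PadicEisenstein (TateModule (GeomPic K 3 (f.map (algebraMap ℤ K))) 3))).toHomUnits

/-- Entries of `ρ_O(g)`: the `b`-coordinates of `g b_j`. [folklore] -/
theorem picardMatrixRepO_apply (b : Module.Basis (Fin 3) PadicEisenstein (TateModule (GeomPic K 3 (f.map (algebraMap ℤ K))) 3))
    (g : absoluteGaloisGroup K) (i j : Fin 3) :
    ((picardMatrixRepO b g : GL (Fin 3) PadicEisenstein) : Matrix (Fin 3) (Fin 3) PadicEisenstein) i j =
      b.repr (g • b j) i := by
  change LinearMap.toMatrixAlgEquiv b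
    (DistribMulAction.toModuleEnd PadicEisenstein (TateModule (GeomPic K 3 (f.map (algebraMap ℤ K))) 3) g) i j = _
  rw [LinearMap.toMatrixAlgEquiv_apply]
  rfl

/-- `tr ρ_O(g) = tr_{ℤ₃[ω]}(g | T₃ J(C_f))`. [folklore] -/
theorem trace_picardMatrixRepO (b : Module.Basis (Fin 3) PadicEisenstein (TateModule (GeomPic K 3 (f.map (algebraMap ℤ K))) 3))
    (g : absoluteGaloisGroup K) :
    ((picardMatrixRepO b g : GL (Fin 3) PadicEisenstein) : Matrix (Fin 3) (Fin 3) PadicEisenstein).trace =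
      LinearMap.trace PadicEisenstein _
        (DistribMulAction.toModuleEnd PadicEisenstein (TateModule (GeomPic K 3 (f.map (algebraMap ℤ K))) 3) g) := by
  rw [LinearMap.trace_eq_matrix_trace PadicEisenstein b]
  rfl

/-! ### The embedding `ℤ₃[ω] ↪ ℤ̄₃ ⊂ ℚ̄₃` -/

section Embedding

variable (u : PadicAlgCl 3) (hu : u ^ 2 + u + 1 = 0)

include hu in
/-- A primitive cube root of unity of `ℚ̄₃` has norm `1`. [folklore] -/
theorem norm_eq_one_of_sq_add_self_add_one : ‖u‖ = 1 := by
  have h3 : u ^ 3 = 1 := by linear_combination (u - 1) * hu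
  have h := congrArg norm h3
  rw [norm_pow, norm_one] at h
  exact (pow_eq_one_iff_of_nonneg (norm_nonneg u) three_ne_zero).1 h

/-- `‖a‖_{ℚ̄₃} = ‖a‖ ≤ 1` for `a ∈ ℤ₃`. [folklore] -/
theorem norm_algebraMap_padicInt_le_one (a : ℤ_[3]) : ‖algebraMap ℤ_[3] (PadicAlgCl 3) a‖ ≤ 1 := by
  rw [IsScalarTower.algebraMap_apply ℤ_[3] ℚ_[3] (PadicAlgCl 3), PadicInt.algebraMap_apply]
  change ‖((a : ℚ_[3]) : PadicAlgCl 3)‖ ≤ 1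
  rw [PadicAlgCl.norm_extends, ← PadicInt.norm_def]
  exact PadicInt.norm_le_one a

include hu in
/-- The embedding `ℤ₃[ω] → ℚ̄₃`, `ω ↦ u`, lands in the closed unit ball `ℤ̄₃`. [folklore] -/
theorem norm_lift_le_one (z : PadicEisenstein) : ‖PadicEisenstein.lift u hu z‖ ≤ 1 := by
  obtain ⟨a, c, rfl⟩ := PadicEisenstein.exists_eq_add_mul_omega z
  rw [PadicEisenstein.lift_add_mul_omega]
  refine (IsUltrametricDist.norm_add_le_max _ _).trans (max_le (norm_algebraMap_padicInt_le_one a) ?_)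
  rw [norm_mul, norm_eq_one_of_sq_add_self_add_one u hu, mul_one]
  exact norm_algebraMap_padicInt_le_one c

include hu in
/-- `‖1 - u‖ < 1`: `(1 - u)² = -3u`. [folklore] -/
theorem norm_one_sub_lt_one : ‖1 - u‖ < 1 := by
  have hsq : (1 - u) ^ 2 = -3 * u := by linear_combination hu
  have h3 : ‖(3 : PadicAlgCl 3)‖ < 1 := by
    have : ((3 : ℚ_[3]) : PadicAlgCl 3) = 3 := by norm_cast
    rw [← this, PadicAlgCl.norm_extends]
    have h := Padic.norm_p (p := 3)
    rw [show ((3 : ℕ) : ℚ_[3]) = 3 by norm_cast] at h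
    rw [h]; norm_num
  by_contra hle
  rw [not_lt] at hle
  have h1 : 1 ≤ ‖(1 - u) ^ 2‖ := by
    rw [norm_pow]; nlinarith [norm_nonneg (1 - u)]
  rw [hsq, norm_mul, norm_neg, norm_eq_one_of_sq_add_self_add_one u hu, mul_one] at h1
  linarith

/-- **`ℤ₃[ω] → ℤ̄₃`**, `ω ↦ u`: the corestriction of `PadicEisenstein.lift u` to the valuation ring
`ℤ̄₃ = padicAlgClIntegers 3`. [folklore] -/
def eisensteinToIntegers : PadicEisenstein →+* padicAlgClIntegers 3 :=
  (PadicEisenstein.lift u hu).toRingHom.codRestrict (padicAlgClIntegers 3) fun z =>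
    (padicAlgCl_mem_valuationSubring_iff 3 _).2 (norm_lift_le_one u hu z)

/-- Unfolding lemma for `eisensteinToIntegers`. [folklore] -/
@[simp]
theorem coe_eisensteinToIntegers (z : PadicEisenstein) :
    ((eisensteinToIntegers u hu z : padicAlgClIntegers 3) : PadicAlgCl 3) = PadicEisenstein.lift u hu z :=
  rfl

/-- `(padicAlgClIntegers 3).subtype ∘ eisensteinToIntegers = lift u`. [folklore] -/
theorem subtype_comp_eisensteinToIntegers :
    (padicAlgClIntegers 3).subtype.comp (eisensteinToIntegers u hu) = (PadicEisenstein.lift u hu).toRingHom :=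
  RingHom.ext fun _ => rfl

/-- `λ = 1 - ω` reduces to `0` in the residue field of `ℤ̄₃`. [folklore] -/
theorem residue_eisensteinToIntegers_lam :
    IsLocalRing.residue (padicAlgClIntegers 3) (eisensteinToIntegers u hu PadicEisenstein.lam) = 0 := by
  rw [IsLocalRing.residue_eq_zero_iff, mem_maximalIdeal_iff_norm_lt_one (padicAlgCl_mem_valuationSubring_iff 3),
    coe_eisensteinToIntegers, PadicEisenstein.lift_lam]
  exact norm_one_sub_lt_one u hu

/-- `3 = 0` in the residue field of `ℤ̄₃`. [folklore] -/
theorem residue_three_eq_zero : (3 : IsLocalRing.ResidueField (padicAlgClIntegers 3)) = 0 := by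
  have h : (3 : IsLocalRing.ResidueField (padicAlgClIntegers 3)) =
      IsLocalRing.residue (padicAlgClIntegers 3) 3 := by rw [map_ofNat]
  rw [h, IsLocalRing.residue_eq_zero_iff, mem_maximalIdeal_iff_norm_lt_one (padicAlgCl_mem_valuationSubring_iff 3)]
  change ‖(3 : PadicAlgCl 3)‖ < 1
  have : ((3 : ℚ_[3]) : PadicAlgCl 3) = 3 := by norm_cast
  rw [← this, PadicAlgCl.norm_extends]
  have h' := Padic.norm_p (p := 3)
  rw [show ((3 : ℕ) : ℚ_[3]) = 3 by norm_cast] at h'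
  rw [h']; norm_num

end Embedding

/-! ### The framed representation `ρ₁ : Γ_K → GL₃(ℤ₃[ω]) → GL₃(ℚ̄₃)` -/

section Rho

variable (hcard : ∀ n, Nat.card (AddSubgroup.torsionBy (GeomPic K 3 (f.map (algebraMap ℤ K))) (3 ^ n : ℕ)) = 3 ^ (2 * 3 * n))
  (b : Module.Basis (Fin 3) PadicEisenstein (TateModule (GeomPic K 3 (f.map (algebraMap ℤ K))) 3))
  (u : PadicAlgCl 3) (hu : u ^ 2 + u + 1 = 0)

include hcard

/-- The `ℤ₃`-coordinates of the entries of `ρ_O(g)` are continuous in `g` (they are entries of the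
`ℤ₃`-matrix of `g` in the basis `{b_j, ω b_j}`, and `Γ_K` acts continuously on `T₃ J(C_f)` with its
`ℤ₃`-module topology). [cite: SerreAbelianLadic1968, Ch. I §1.1] -/
theorem continuous_repr_picardMatrixRepO (i j : Fin 3) (k : Fin 2) :
    Continuous fun g : absoluteGaloisGroup K =>
      PadicEisenstein.basisFinTwo.repr
        (((picardMatrixRepO b g : GL (Fin 3) PadicEisenstein) : Matrix (Fin 3) (Fin 3) PadicEisenstein) i j) k := by
  haveI := TateModule.free_of_card_torsionBy_rank hcard
  haveI := TateModule.finite_of_card_torsionBy_rank hcard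
  haveI : IsModuleTopology ℤ_[3] (TateModule (GeomPic K 3 (f.map (algebraMap ℤ K))) 3) :=
    TateModule.isModuleTopology
  set B : Module.Basis (Fin 6) ℤ_[3] (TateModule (GeomPic K 3 (f.map (algebraMap ℤ K))) 3) :=
    (PadicEisenstein.basisFinTwo.smulTower b).reindex finProdFinEquiv with hB
  have hc := (picardTateGaloisRep K f hf4.out hfs.out).continuous_toMatrix B
  have heq : (fun g : absoluteGaloisGroup K => PadicEisenstein.basisFinTwo.repr
      (((picardMatrixRepO b g : GL (Fin 3) PadicEisenstein) : Matrix (Fin 3) (Fin 3) PadicEisenstein) i j) k) =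
      fun g => LinearMap.toMatrix B B (picardTateGaloisRep K f hf4.out hfs.out g)
        (finProdFinEquiv (k, i)) (finProdFinEquiv ((0 : Fin 2), j)) := by
    funext g
    rw [LinearMap.toMatrix_apply, hB, Module.Basis.reindex_apply, Module.Basis.repr_reindex_apply, Equiv.symm_apply_apply,
      Equiv.symm_apply_apply, Module.Basis.smulTower_apply, PadicEisenstein.basisFinTwo_zero, one_smul,
      Module.Basis.smulTower_repr, picardMatrixRepO_apply]
    rfl
  rw [heq]
  exact hc.matrix_elem _ _

/-- The entries of `σ(ρ_O(g))` (`σ : ℤ₃[ω] → ℚ̄₃`, `ω ↦ u`) are continuous in `g`. [folklore] -/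
theorem continuous_lift_picardMatrixRepO (i j : Fin 3) :
    Continuous fun g : absoluteGaloisGroup K => PadicEisenstein.lift u hu
      (((picardMatrixRepO b g : GL (Fin 3) PadicEisenstein) : Matrix (Fin 3) (Fin 3) PadicEisenstein) i j) := by
  set z : absoluteGaloisGroup K → PadicEisenstein := fun g =>
    ((picardMatrixRepO b g : GL (Fin 3) PadicEisenstein) : Matrix (Fin 3) (Fin 3) PadicEisenstein) i j with hz
  have hzrepr : ∀ g, z g = algebraMap ℤ_[3] PadicEisenstein (PadicEisenstein.basisFinTwo.repr (z g) 0) +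
      algebraMap ℤ_[3] PadicEisenstein (PadicEisenstein.basisFinTwo.repr (z g) 1) * PadicEisenstein.omega := by
    intro g
    conv_lhs => rw [← PadicEisenstein.basisFinTwo.sum_repr (z g)]
    rw [Fin.sum_univ_two, PadicEisenstein.basisFinTwo_zero, PadicEisenstein.basisFinTwo_one, Algebra.smul_def,
      mul_one, Algebra.smul_def]
  have hfun : (fun g => PadicEisenstein.lift u hu (z g)) = fun g =>
      algebraMap ℤ_[3] (PadicAlgCl 3) (PadicEisenstein.basisFinTwo.repr (z g) 0) +
        algebraMap ℤ_[3] (PadicAlgCl 3) (PadicEisenstein.basisFinTwo.repr (z g) 1) * u := by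
    funext g
    conv_lhs => rw [hzrepr g]
    rw [PadicEisenstein.lift_add_mul_omega]
  change Continuous fun g => PadicEisenstein.lift u hu (z g)
  rw [hfun]
  have halg : Continuous (algebraMap ℤ_[3] (PadicAlgCl 3)) := by
    have : (algebraMap ℤ_[3] (PadicAlgCl 3) : ℤ_[3] → PadicAlgCl 3) =
        (algebraMap ℚ_[3] (PadicAlgCl 3)) ∘ ((↑) : ℤ_[3] → ℚ_[3]) := by
      funext a
      rw [Function.comp_apply, IsScalarTower.algebraMap_apply ℤ_[3] ℚ_[3] (PadicAlgCl 3), PadicInt.algebraMap_apply]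
    rw [this]
    exact (continuous_algebraMap ℚ_[3] (PadicAlgCl 3)).comp continuous_subtype_val
  exact ((halg.comp (continuous_repr_picardMatrixRepO hcard b i j 0))).add
    ((halg.comp (continuous_repr_picardMatrixRepO hcard b i j 1)).mul continuous_const)

/-- **`ρ₀ : Γ_K → GL₃(ℤ̄₃)`**, `ρ_O` pushed along `ℤ₃[ω] → ℤ̄₃`, `ω ↦ u`. [cite: Upton2009, §2] -/
def picardRho0 : absoluteGaloisGroup K →* GL (Fin 3) (padicAlgClIntegers 3) :=
  (Matrix.GeneralLinearGroup.map (eisensteinToIntegers u hu)).comp (picardMatrixRepO b)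

/-- **`ρ₁ : Γ_K → GL₃(ℚ̄₃)`**, the Tate module `T₃ J(C_f) ≅ ℤ₃[ω]³` of the Picard curve viewed over
`ℚ̄₃` through `ω ↦ u`, as a framed continuous representation. [cite: Upton2009, §2] -/
def picardRho1 : FramedGaloisRep K (PadicAlgCl 3) 3 where
  toMonoidHom := (Matrix.GeneralLinearGroup.map (padicAlgClIntegers 3).subtype).comp (picardRho0 b u hu)
  continuous_toFun := by
    have h1 : Continuous fun g : absoluteGaloisGroup K =>
        (((Matrix.GeneralLinearGroup.map (padicAlgClIntegers 3).subtype).comp (picardRho0 b u hu) g :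
          GL (Fin 3) (PadicAlgCl 3)) : Matrix (Fin 3) (Fin 3) (PadicAlgCl 3)) :=
      continuous_matrix fun i j => continuous_lift_picardMatrixRepO hcard b u hu i j
    refine Units.continuous_iff.2 ⟨h1, ?_⟩
    have h3 := h1.comp (continuous_inv (G := absoluteGaloisGroup K))
    refine (continuous_congr fun g => ?_).1 h3
    simp only [Function.comp_apply, map_inv]
    rfl

/-- Entries of `ρ₁(g)`: `σ` of the entries of `ρ_O(g)`. [folklore] -/
theorem picardRho1_apply_coe (g : absoluteGaloisGroup K) (i j : Fin 3) :
    ((picardRho1 hcard b u hu g : GL (Fin 3) (PadicAlgCl 3)) : Matrix (Fin 3) (Fin 3) (PadicAlgCl 3)) i j =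
      PadicEisenstein.lift u hu
        (((picardMatrixRepO b g : GL (Fin 3) PadicEisenstein) : Matrix (Fin 3) (Fin 3) PadicEisenstein) i j) :=
  rfl

/-- `tr ρ₁(g) = σ(tr_{ℤ₃[ω]}(g | T₃ J(C_f)))`. [folklore] -/
theorem trace_picardRho1 (g : absoluteGaloisGroup K) :
    FramedRep.trace (picardRho1 hcard b u hu) g = PadicEisenstein.lift u hu
      (LinearMap.trace PadicEisenstein _
        (DistribMulAction.toModuleEnd PadicEisenstein (TateModule (GeomPic K 3 (f.map (algebraMap ℤ K))) 3) g)) := by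
  rw [← trace_picardMatrixRepO b, FramedRep.trace, Matrix.trace, Matrix.trace, map_sum]
  rfl

/-- The underlying homomorphism of `ρ₁` is `GL₃(ℤ̄₃ ⊆ ℚ̄₃) ∘ ρ₀`. [folklore] -/
theorem coe_picardRho1 :
    ((picardRho1 hcard b u hu : FramedGaloisRep K (PadicAlgCl 3) 3) : absoluteGaloisGroup K →* GL (Fin 3) (PadicAlgCl 3)) =
      (Matrix.GeneralLinearGroup.map (padicAlgClIntegers 3).subtype).comp (picardRho0 b u hu) :=
  rfl

end Rho

/-! ### Residual absolute irreducibility -/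

/-- **`ρ̄₁ ≅ (𝔽₃^{roots})⁰ ⊗ 𝔽̄₃` is absolutely irreducible, hence so is `ρ₁`.**  In the basis of
`picard_exists_basis_repr_smul_congr` the reduction of `ρ₀` modulo the maximal ideal of `ℤ̄₃` has
matrices `C(γ) = ([γ x = y] - [γ r₀ = y])_{y,x}`, i.e. it is the augmentation representation of
`Γ_K` on the four roots of `f` over `𝔽̄₃`, irreducible over every extension since `Gal(f) ⊇ A₄`
(`augmentationRep_rootSet_map_isIrreducible`); so `ρ₁` is residually absolutely irreducible
(`IsResiduallyAbsIrreducible`) and therefore absolutely irreducible. (Upton 2009 §3–§4.)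
[cite: Upton2009, §4] [cite: DarmonDiamondTaylor1995, §2.1] -/
theorem picardRho1_isAbsolutelyIrreducible [NumberField K]
    (hcard : ∀ n, Nat.card (AddSubgroup.torsionBy (GeomPic K 3 (f.map (algebraMap ℤ K))) (3 ^ n : ℕ)) = 3 ^ (2 * 3 * n))
    (h12 : 12 ∣ Nat.card (f.map (Int.castRingHom ℚ)).Gal)
    {r₀ : (f.map (algebraMap ℤ K)).rootSet (AlgebraicClosure K)}
    (e : {y : (f.map (algebraMap ℤ K)).rootSet (AlgebraicClosure K) // y ≠ r₀} ≃ Fin 3)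
    (b : Module.Basis {y : (f.map (algebraMap ℤ K)).rootSet (AlgebraicClosure K) // y ≠ r₀} PadicEisenstein
      (TateModule (GeomPic K 3 (f.map (algebraMap ℤ K))) 3))
    (hb : ∀ (γ : absoluteGaloisGroup K) (y x : {y : (f.map (algebraMap ℤ K)).rootSet (AlgebraicClosure K) // y ≠ r₀}),
      ∃ q : PadicEisenstein, b.repr (γ • b x) y =
        (by classical exact (augStdMatrix ℤ r₀ γ y x : PadicEisenstein)) + PadicEisenstein.lam * q)
    (u : PadicAlgCl 3) (hu : u ^ 2 + u + 1 = 0) :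
    FramedRep.IsAbsolutelyIrreducible (picardRho1 hcard (b.reindex e) u hu) := by
  classical
  refine FramedGaloisRep.IsResiduallyAbsIrreducible.isAbsolutelyIrreducible three_pos ?_
  refine ⟨integralReduction (RingHom.id _) (picardRho0 (b.reindex e) u hu),
    ⟨picardRho0 (b.reindex e) u hu, 1, isIntegralModelOf_map _, fun g => by rw [inv_one, one_mul, mul_one]⟩, ?_⟩
  intro k' _ φ
  -- `char k' = 3`, so `2 ≠ 0` in `k'`
  have h2 : (2 : k') ≠ 0 := by
    intro h2
    have h3 : (3 : k') = 0 := by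
      have := congrArg φ residue_three_eq_zero
      rwa [map_ofNat, map_zero] at this
    exact one_ne_zero (by linear_combination h3 - h2 : (1 : k') = 0)
  refine isIrreducible_glStd_comp_of_coe_eq_reindex_augStdMatrix r₀ e _ (fun g => ?_)
    (augmentationRep_rootSet_map_isIrreducible (K := K) f hf4.out hfs.out h12 h2)
  ext i j
  obtain ⟨q, hq⟩ := hb g (e.symm i) (e.symm j)
  rw [Matrix.reindex_apply, Matrix.submatrix_apply, ← augStdMatrix_map_intCast k' r₀ g, Matrix.map_apply]
  change φ (IsLocalRing.residue (padicAlgClIntegers 3) (eisensteinToIntegers u hu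
    ((((picardMatrixRepO (b.reindex e) g : GL (Fin 3) PadicEisenstein) : Matrix (Fin 3) (Fin 3) PadicEisenstein) i j)))) = _
  rw [picardMatrixRepO_apply, Module.Basis.reindex_apply, Module.Basis.repr_reindex_apply, hq, map_add, map_mul,
    map_add, map_mul, residue_eisensteinToIntegers_lam, zero_mul, add_zero, map_intCast, map_intCast, map_intCast]

end PicardFrame

end Literature.NumberTheory.GaloisRepresentations
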